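import Literature.NumberTheory.GelbartRogawski1991.LocalUnitarySplittingDatum
import Literature.RepresentationTheory.HeisenbergGroup.SchrodingerLeraySectionGram
import HarnessLib

/-!
# The Leray-normalised section of the local Schrödinger model `localSchrodinger F N T v` (Rao's Theorem 4.1 at a finite place)

Topic `NumberTheory/GelbartRogawski1991`; namespace
`Literature.NumberTheory.GelbartRogawski1991.UnitaryDualPair.LocalSplitting` (the namespace of the INTERFACE file
`LocalUnitarySplittingDatum.lean`, v2). KERNEL ONLY: proved theorems; no definition, no named fact, no `sorry`.

For a number field `F`, a finite place `v`, an `F`-rational Gram matrix `T ∈ GL_N(F)` and the local smooth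
Schrödinger model `localSchrodinger F N T v = schrodingerSB β_{𝕋_v} ψ_v` on `𝒮(F_vᴺ)` (`ψ_v = adeleAddCharAt F v`) of the
interface file, this file supplies — as THEOREMS over the tree, by specialising
`HeisenbergGroup/SchrodingerLeraySectionGram.lean` to `F_v`, `𝕋_v = T ⊗ 1` — the three inputs of the local datum
`LocalSplittingDatum` that concern the Schrödinger model alone ([Rangarao1993, Thm 4.1]; [MoeglinVignerasWaldspurger1987,
Chap. 2 II.1, Chap. 3 §I.3]):
* `implementerUniqueUpToScalar_localSchrodinger` — implementers are unique up to scalars (field `hU`);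
* `existsImplementer_localSchrodinger`, `isCentralExt_localSchrodinger` — every `g ∈ Sp(𝕎_v)` is implemented,
  `1 → ℂˣ → S̃p_{ψ_v}(𝕎_v) → Sp(𝕎_v) → 1` is a central extension;
* **`exists_leraySection_half`** — for EVERY Lagrangian `ℓ` of `𝕎_v` and every Haar measure `μ` on `F_v` there
  are `hU` and a normalised implementer section `r` with
  `r.cocycle hU g₁ g₂ = localLeray F N T hTd v μ (ψ_v(½·)) _ ℓ hℓ g₁ g₂` for all `g₁, g₂ ∈ Sp(𝕎_v)`, i.e. the
  multiplier of `r` is the Leray cocycle of `ℓ` **for the character `ψ_v(½·)`** — RAO'S `½`: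
  "`c(σ₁, σ₂)` = the Weil index of `x ↦ χ(½ q(x))`, `q` the Leray invariant" ([Rangarao1993] Thm 4.1 (5), p. 358),
  MVW's "`c(g, g') = γ(ψ ∘ ½ q(g, g'))`" ([MoeglinVignerasWaldspurger1987] Chap. 3 §I.3);
* **`exists_leraySection`** — the same with the character existentially bound,
  `∃ hU r ψ' hψ', ∀ g₁ g₂, r.cocycle hU g₁ g₂ = localLeray F N T hTd v μ ψ' hψ' ℓ hℓ g₁ g₂`: EXACTLY the shape of the
  fields `hU`, `r`, `cocycle_eq` of `LocalSplittingDatum` (v2: the datum does not pin the character).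
The Leray cocycles for `ψ_v` and for `ψ_v(½·)` are cohomologous ([Rangarao1993] Thm 5.3: both normalise to Rao's
`±1`-valued cocycle) but not equal termwise unless `2` is a square in `F_v`.

## References

* R. Ranga Rao, Pacific J. Math. 157 (1993) 335–371, Thm 4.1 (5) p. 358, Thm 5.3 [Rangarao1993].
* C. Mœglin, M.-F. Vignéras, J.-L. Waldspurger, LNM 1291 (1987), Chap. 2 II.1, Chap. 3 §I.3
  [MoeglinVignerasWaldspurger1987].
* S. Gelbart, J. Rogawski, Invent. Math. 105 (1991), §3.1 p. 455 [GelbartRogawski1991].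
* A. Weil, Acta Math. 111 (1964), Chap. II n° 24 [Weil1964].
-/

set_option autoImplicit false

noncomputable section

open NumberField IsDedekindDomain MeasureTheory Matrix
open Literature.RepresentationTheory.HeisenbergGroup
open Literature.NumberTheory.Automorphic Literature.NumberTheory.Weil1964
open Literature.NumberTheory.GaloisRepresentations.IsNonarchimedeanLocalField

namespace Literature.NumberTheory.GelbartRogawski1991.UnitaryDualPair.LocalSplitting

variable (F : Type) [Field F] [NumberField F] (N : ℕ) (T : Matrix (Fin N) (Fin N) F) (hTd : IsUnit T.det)
  (v : HeightOneSpectrum (𝓞 F))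

/-! ## §1 The local data at `v`: `det 𝕋_v` a unit, continuity of `β_{𝕋_v}(·, y)`, the character `ψ_v(½·)` -/

include hTd in
/-- `det 𝕋_v` is a unit. [folklore] -/
private theorem isUnit_det_localGram : IsUnit (localGram F N T v).det :=
  UnitaryGroup.isUnit_det_map (algebraMap F (v.adicCompletion F)) hTd

/-- `β_{𝕋_v}(·, y)` is continuous (a linear form on `F_vᴺ`). [folklore] -/
private theorem continuous_localPairing_left' (y : Fin N → v.adicCompletion F) :
    Continuous fun u : Fin N → v.adicCompletion F => localPairing F N T v u y := by
  simp only [Matrix.toLinearMap₂'_apply', dotProduct]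
  exact continuous_finsetSum _ fun i _ => (continuous_apply i).mul continuous_const

/-- **`ψ_v(½·)` is a non-trivial continuous character of `F_v`** (Rao's character `x ↦ χ(½x)`).
[cite: Rangarao1993, Thm 4.1 (5), p. 358] -/
theorem isContinuousNontrivial_adeleAddCharAt_half :
    ((adeleAddCharAt F v).mulShift (⅟(2 : v.adicCompletion F))).IsContinuousNontrivial :=
  isContinuousNontrivial_mulShift_half (isContinuousNontrivial_adeleAddCharAt F v)

/-! ## §2 Implementers of `localSchrodinger F N T v` -/

include hTd in
/-- **implementers of the local Schrödinger model are unique up to scalars** (field `hU` of `LocalSplittingDatum`).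
[cite: MoeglinVignerasWaldspurger1987, Chap. 2 II.1 (A)] -/
theorem implementerUniqueUpToScalar_localSchrodinger : ImplementerUniqueUpToScalar (localSchrodinger F N T v) :=
  implementerUniqueUpToScalar_schrodingerSB_gram (localGram F N T v) (isUnit_det_localGram F N T hTd v)
    (isLocallyConstant_of_isContinuousNontrivial (isContinuousNontrivial_adeleAddCharAt F v))
    (continuous_localPairing_left' F N T v) (isContinuousNontrivial_adeleAddCharAt F v)

include hTd in
/-- **every `g ∈ Sp(𝕎_v)` is implemented on `𝒮(F_vᴺ)`**. [cite: MoeglinVignerasWaldspurger1987, Chap. 2 II.1 (A), II.6] -/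
theorem existsImplementer_localSchrodinger : ExistsImplementer (localSchrodinger F N T v) :=
  existsImplementer_schrodingerSB_gram (localGram F N T v) (isUnit_det_localGram F N T hTd v)
    (isLocallyConstant_of_isContinuousNontrivial (isContinuousNontrivial_adeleAddCharAt F v))
    (continuous_localPairing_left' F N T v) (isContinuousNontrivial_adeleAddCharAt F v)

include hTd in
/-- **`1 → ℂˣ → LocalMp → Sp(𝕎_v) → 1` is a central extension**. [cite: MoeglinVignerasWaldspurger1987, Chap. 2 II.1 (B)] -/
theorem isCentralExt_localSchrodinger :
    Literature.RepresentationTheory.MoeglinVignerasWaldspurger1987.IsCentralExt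
      (MpPsi.ofScalar (localSchrodinger F N T v)) (MpPsi.proj (localSchrodinger F N T v)) :=
  isCentralExt_MpPsi _ (existsImplementer_localSchrodinger F N T hTd v)
    (implementerUniqueUpToScalar_localSchrodinger F N T hTd v)

variable [MeasurableSpace (v.adicCompletion F)] [BorelSpace (v.adicCompletion F)]
  (μ : Measure (v.adicCompletion F)) [μ.IsAddHaarMeasure]
variable (ψ' : AddChar (v.adicCompletion F) Circle) (hψ' : ψ'.IsContinuousNontrivial)
  (ℓ : Submodule (v.adicCompletion F) ((Fin N → v.adicCompletion F) × (Fin N → v.adicCompletion F)))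
  (hℓ : LinearMap.BilinForm.orthogonal (alt (polar (localPairing F N T v))) ℓ = ℓ)

/-- the value of the interface's Leray cocycle: `(c^{ψ'}_ℓ(g₁, g₂) : ℂ) = lerayCocycle ψ' μ A ℓ g₁ g₂`.
[cite: MoeglinVignerasWaldspurger1987, Chap. 3 §I.3] -/
@[simp] theorem coe_localLeray_apply (g₁ g₂ : LocalSp F N T v) :
    ((localLeray F N T hTd v μ ψ' hψ' ℓ hℓ g₁ g₂ : ℂˣ) : ℂ) =
      lerayCocycle ψ' μ (alt (polar (localPairing F N T v))) ℓ g₁.1 g₂.1 := rfl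

/-- **`localLeray` does not depend on the Haar measure** (the Weil index of a quadratic form is independent of the
Haar measure used to define it). [cite: Weil1964, Chap. II n° 24, p. 173] -/
theorem localLeray_eq_of_isAddHaarMeasure (μ' : Measure (v.adicCompletion F)) [μ'.IsAddHaarMeasure] :
    localLeray F N T hTd v μ' ψ' hψ' ℓ hℓ = localLeray F N T hTd v μ ψ' hψ' ℓ hℓ :=
  Literature.GroupTheory.CentralCocycle.ext fun g₁ g₂ => Units.ext (by
    rw [coe_localLeray_apply, coe_localLeray_apply]
    exact lerayCocycle_eq_of_isAddHaarMeasure μ μ' hψ' _ ℓ g₁.1 g₂.1)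

/-! ## §3 The Leray-normalised section (Rao's Theorem 4.1 at `v`) -/

/-- **RAO'S THEOREM 4.1 AT THE PLACE `v`, for the character `ψ_v(½·)`**: for every Lagrangian `ℓ` of `𝕎_v` and every
Haar measure `μ` on `F_v` there are a uniqueness witness `hU` and a normalised implementer section `r` of
`localSchrodinger F N T v` with `c_r(g₁, g₂) = c^{ψ_v(½·)}_ℓ(g₁, g₂)` for all `g₁, g₂ ∈ Sp(𝕎_v)`.
[cite: Rangarao1993, Thm 4.1 (5), p. 358; MoeglinVignerasWaldspurger1987, Chap. 3 §I.3 Théorème] -/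
theorem exists_leraySection_half :
    ∃ (hU : ImplementerUniqueUpToScalar (localSchrodinger F N T v)) (r : ImplementerSection (localSchrodinger F N T v)),
      ∀ g₁ g₂ : LocalSp F N T v, r.cocycle hU g₁ g₂ =
        localLeray F N T hTd v μ ((adeleAddCharAt F v).mulShift (⅟(2 : v.adicCompletion F)))
          (isContinuousNontrivial_adeleAddCharAt_half F v) ℓ hℓ g₁ g₂ :=
  exists_hU_implementerSection_cocycle_eq_lerayCentralCocycle_gram (localGram F N T v) (isUnit_det_localGram F N T hTd v)
    (isLocallyConstant_of_isContinuousNontrivial (isContinuousNontrivial_adeleAddCharAt F v))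
    (continuous_localPairing_left' F N T v) μ (isContinuousNontrivial_adeleAddCharAt F v) hℓ _ _

/-- **the `L0` input of the GR-1 local skeleton, in the shape of the fields `hU`, `r`, `cocycle_eq` of
`LocalSplittingDatum` (v2)**: there are `hU`, a normalised implementer section `r` of `localSchrodinger F N T v` and a
continuous non-trivial character `ψ'` of `F_v` (namely `ψ' = ψ_v(½·)`) with
`r.cocycle hU g₁ g₂ = localLeray F N T hTd v μ ψ' hψ' ℓ hℓ g₁ g₂` for all `g₁, g₂`.
[cite: Rangarao1993, Thm 4.1 (5), p. 358; MoeglinVignerasWaldspurger1987, Chap. 3 §I.3 Théorème] -/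
theorem exists_leraySection :
    ∃ (hU : ImplementerUniqueUpToScalar (localSchrodinger F N T v)) (r : ImplementerSection (localSchrodinger F N T v))
      (ψ' : AddChar (v.adicCompletion F) Circle) (hψ' : ψ'.IsContinuousNontrivial),
      ∀ g₁ g₂ : LocalSp F N T v, r.cocycle hU g₁ g₂ = localLeray F N T hTd v μ ψ' hψ' ℓ hℓ g₁ g₂ := by
  obtain ⟨hU, r, h⟩ := exists_leraySection_half F N T hTd v μ ℓ hℓ
  exact ⟨hU, r, _, _, h⟩

/-- the section with the file's fixed uniqueness witness, as an equality of central cocycles.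
[cite: Rangarao1993, Thm 4.1 (5), p. 358] -/
theorem exists_implementerSection_cocycle_eq_localLeray_half :
    ∃ r : ImplementerSection (localSchrodinger F N T v),
      r.cocycle (implementerUniqueUpToScalar_localSchrodinger F N T hTd v) =
        localLeray F N T hTd v μ ((adeleAddCharAt F v).mulShift (⅟(2 : v.adicCompletion F)))
          (isContinuousNontrivial_adeleAddCharAt_half F v) ℓ hℓ := by
  obtain ⟨hU, r, h⟩ := exists_leraySection_half F N T hTd v μ ℓ hℓ
  exact ⟨r, Literature.GroupTheory.CentralCocycle.ext fun g₁ g₂ => h g₁ g₂⟩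

end Literature.NumberTheory.GelbartRogawski1991.UnitaryDualPair.LocalSplitting
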